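import Literature.NumberTheory.EllipticCurves.ShintaniThetaInversion
import Literature.Algebra.EuclideanLattices.DiscreteGaussianInt
import HarnessLib

/-!
# A uniform bound for Shintani's majorant theta sums high in the cusp

[[cite: Shintani1975, §2 (proof of Prop. 2.1)]] — for the unfolding of Shintani's theta lift one
needs that `∑_{x ∈ ℤ³} |x(w,1)| e^{-a · majorant_w(x)}` grows at most polynomially in `Im w`,
UNIFORMLY in `Re w` (so that against a cusp form `φ(w)` the integrand is integrable on a fundamental
domain).  We PROVE, for `a > 0`, `v₀ > 0` and every `w` with `Im w ≥ v₀`: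

* `majorant_eq` — completing squares,
  `majorant_w(x) = 2v²x₀² + (2ux₀ + x₁)² + 2(u²x₀ + ux₁ + x₂)²/v²` (`w = u + iv`);
* `sum_exp_neg_majorant_le` / `tsum_exp_neg_majorant_le` —
  `∑_{x ∈ ℤ³} e^{-a·majorant_w(x)} ≤ Θ(2av₀²) Θ(a) Θ(2a/v₀²) · (Im w / v₀)`, `Θ(b) = ∑_{k ∈ ℤ} e^{-bk²}`,
  by summing the innermost shifted one-dimensional Gaussian with Banaszczyk's lemma
  (`tsum_gaussianFunction_sub_le_pow_mul` of the tree: a shift never increases, and scaling the width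
  by `t ≥ 1` multiplies by at most `t`, the Gaussian mass of `ℤ`) — this is what makes the bound
  uniform in `Re w`;
* `norm_formEval_sq_le` — `|x(w,1)|² ≤ (Im w)² majorant_w(x)`, hence
  `tsum_norm_formEval_mul_exp_le` — `∑_x |x(w,1)| e^{-a·majorant_w(x)} ≤ C(a, v₀) (Im w)²`.

Everything is proved; no facts; the only definitions are `thetaZ` and the coordinate vector `vec`.
-/

noncomputable section

open Complex Real

namespace Literature.NumberTheory.EllipticCurves.Shintani

open UpperHalfPlane hiding I
open Literature.Algebra.EuclideanLattices (gaussianFunction intLattice intLatticeEquiv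
  coe_intLatticeEquiv tsum_gaussianFunction_sub_le tsum_gaussianFunction_sub_le_pow_mul
  summable_gaussianFunction_sub gaussianFunction_pos)

/-! ### One-dimensional shifted Gaussian sums -/

/-- `Θ(b) = ∑_{k ∈ ℤ} e^{-b k²}`. [folklore] -/
def thetaZ (b : ℝ) : ℝ := ∑' k : ℤ, Real.exp (-b * (k : ℝ) ^ 2)

/-- The Gaussian `ρ_s` on `ℝ`: `ρ_s(x) = e^{-π x²/s²}`. [folklore] -/
theorem gaussianFunction_real (s x : ℝ) : gaussianFunction s x = Real.exp (-π * x ^ 2 / s ^ 2) := by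
  rw [gaussianFunction, Real.norm_eq_abs, sq_abs]

/-- With `s = √(π/b)`: `ρ_s(x) = e^{-b x²}`. [folklore] -/
theorem gaussianFunction_sqrt_pi_div {b : ℝ} (hb : 0 < b) (x : ℝ) :
    gaussianFunction (Real.sqrt (π / b)) x = Real.exp (-b * x ^ 2) := by
  rw [gaussianFunction_real, Real.sq_sqrt (by positivity)]
  congr 1
  field_simp

/-- With `s = t √(π/b)`: `ρ_s(x) = e^{-(b/t²) x²}`. [folklore] -/
theorem gaussianFunction_mul_sqrt_pi_div {b t : ℝ} (hb : 0 < b) (ht : 0 < t) (x : ℝ) :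
    gaussianFunction (t * Real.sqrt (π / b)) x = Real.exp (-(b / t ^ 2) * x ^ 2) := by
  rw [gaussianFunction_real, mul_pow, Real.sq_sqrt (by positivity)]
  congr 1
  field_simp

/-- The shifted Gaussian sum over `ℤ`, transported to the tree's lattice `intLattice ⊆ ℝ`. [folklore] -/
theorem tsum_int_eq_tsum_intLattice (g : ℝ → ℝ) :
    ∑' k : ℤ, g k = ∑' y : intLattice, g (y : ℝ) := by
  rw [← intLatticeEquiv.tsum_eq]
  rfl

/-- Summability of `k ↦ ρ_s(k - c)` over `ℤ`. [folklore] -/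
theorem summable_gaussianFunction_int_sub {s : ℝ} (hs : s ≠ 0) (c : ℝ) :
    Summable fun k : ℤ ↦ gaussianFunction s ((k : ℝ) - c) := by
  have h := (summable_gaussianFunction_sub intLattice hs c)
  rw [← intLatticeEquiv.summable_iff] at h
  exact h

/-- **Shifted partial sums are bounded by the centred mass**:
`∑_{k ∈ I} e^{-b(k - c)²} ≤ Θ(b)` (Banaszczyk). [cite: Shintani1975, §2] -/
theorem sum_exp_neg_mul_sq_sub_le {b : ℝ} (hb : 0 < b) (c : ℝ) (I : Finset ℤ) :
    ∑ k ∈ I, Real.exp (-b * ((k : ℝ) - c) ^ 2) ≤ thetaZ b := by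
  set s : ℝ := Real.sqrt (π / b) with hs
  have hs0 : 0 < s := Real.sqrt_pos.mpr (by positivity)
  have e1 : ∀ x : ℝ, Real.exp (-b * x ^ 2) = gaussianFunction s x := fun x ↦
    (gaussianFunction_sqrt_pi_div hb x).symm
  simp_rw [thetaZ, e1]
  calc ∑ k ∈ I, gaussianFunction s ((k : ℝ) - c)
      ≤ ∑' k : ℤ, gaussianFunction s ((k : ℝ) - c) :=
        (summable_gaussianFunction_int_sub hs0.ne' c).sum_le_tsum I
          (fun k _ ↦ (gaussianFunction_pos _ _).le)
    _ = ∑' y : intLattice, gaussianFunction s ((y : ℝ) - c) :=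
        tsum_int_eq_tsum_intLattice (fun x ↦ gaussianFunction s (x - c))
    _ ≤ ∑' y : intLattice, gaussianFunction s (y : ℝ) := tsum_gaussianFunction_sub_le intLattice hs0 c
    _ = ∑' k : ℤ, gaussianFunction s (k : ℝ) := (tsum_int_eq_tsum_intLattice _).symm

/-- **Scaled shifted sums**: `∑_{k ∈ I} e^{-(b/t²)(k - c)²} ≤ t Θ(b)` for `t ≥ 1`. [cite: Shintani1975, §2] -/
theorem sum_exp_neg_mul_sq_sub_le_mul {b t : ℝ} (hb : 0 < b) (ht : 1 ≤ t) (c : ℝ) (I : Finset ℤ) :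
    ∑ k ∈ I, Real.exp (-(b / t ^ 2) * ((k : ℝ) - c) ^ 2) ≤ t * thetaZ b := by
  set s : ℝ := Real.sqrt (π / b) with hs
  have hs0 : 0 < s := Real.sqrt_pos.mpr (by positivity)
  have ht0 : 0 < t := one_pos.trans_le ht
  have e1 : ∀ x : ℝ, Real.exp (-(b / t ^ 2) * x ^ 2) = gaussianFunction (t * s) x := fun x ↦
    (gaussianFunction_mul_sqrt_pi_div hb ht0 x).symm
  have e2 : ∀ x : ℝ, Real.exp (-b * x ^ 2) = gaussianFunction s x := fun x ↦
    (gaussianFunction_sqrt_pi_div hb x).symm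
  simp_rw [thetaZ, e1, e2]
  have hts : (t * s) ≠ 0 := (mul_pos ht0 hs0).ne'
  calc ∑ k ∈ I, gaussianFunction (t * s) ((k : ℝ) - c)
      ≤ ∑' k : ℤ, gaussianFunction (t * s) ((k : ℝ) - c) :=
        (summable_gaussianFunction_int_sub hts c).sum_le_tsum I
          (fun k _ ↦ (gaussianFunction_pos _ _).le)
    _ = ∑' y : intLattice, gaussianFunction (t * s) ((y : ℝ) - c) :=
        tsum_int_eq_tsum_intLattice (fun x ↦ gaussianFunction (t * s) (x - c))
    _ ≤ t ^ Module.finrank ℝ ℝ * ∑' y : intLattice, gaussianFunction s (y : ℝ) :=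
        tsum_gaussianFunction_sub_le_pow_mul intLattice hs0 ht c
    _ = t * ∑' k : ℤ, gaussianFunction s (k : ℝ) := by
        rw [Module.finrank_self, pow_one, (tsum_int_eq_tsum_intLattice _)]

/-- `Θ(b) ≥ 0`. [folklore] -/
theorem thetaZ_nonneg (b : ℝ) : 0 ≤ thetaZ b :=
  tsum_nonneg fun _ ↦ (Real.exp_pos _).le

/-! ### The majorant in cusp coordinates -/

/-- The coordinate vector of `k ∈ ℤ³`. [folklore] -/
def vec (k : Fin 3 → ℤ) : V := WithLp.toLp 2 fun i ↦ (k i : ℝ)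

/-- `vec k i = k i`. [folklore] -/
@[simp] theorem vec_apply (k : Fin 3 → ℤ) (i : Fin 3) : vec k i = k i := rfl

/-- **Completing squares** (`w = u + iv`):
`majorant_w(x) = 2v²x₀² + (2ux₀ + x₁)² + 2(u²x₀ + ux₁ + x₂)²/v²`. [cite: Shintani1975, §2] -/
theorem majorant_eq (w : ℍ) (x : V) :
    majorant w x = 2 * w.im ^ 2 * x 0 ^ 2 + (2 * w.re * x 0 + x 1) ^ 2 +
      2 * (w.re ^ 2 * x 0 + w.re * x 1 + x 2) ^ 2 / w.im ^ 2 := by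
  have hv : w.im ≠ 0 := w.im_pos.ne'
  rw [majorant, disc, pw, Complex.normSq_apply]
  rw [show (w : ℂ).re = w.re from rfl, show (w : ℂ).im = w.im from rfl]
  field_simp
  ring

/-- `|x(w,1)|² ≤ (Im w)² majorant_w(x)`. [folklore] -/
theorem norm_formEval_sq_le (w : ℍ) (x : V) :
    ‖formEval x w‖ ^ 2 ≤ w.im ^ 2 * majorant w x := by
  have hv : 0 < w.im := w.im_pos
  have hsq_re : ((w : ℂ) ^ 2).re = w.re ^ 2 - w.im ^ 2 := by
    rw [sq, mul_re, UpperHalfPlane.coe_re, UpperHalfPlane.coe_im]; ring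
  have hsq_im : ((w : ℂ) ^ 2).im = 2 * w.re * w.im := by
    rw [sq, mul_im, UpperHalfPlane.coe_re, UpperHalfPlane.coe_im]; ring
  have hre : (formEval x w).re = (w.re ^ 2 * x 0 + w.re * x 1 + x 2) - x 0 * w.im ^ 2 := by
    simp only [formEval, add_re, mul_re, ofReal_re, ofReal_im, zero_mul, sub_zero,
      UpperHalfPlane.coe_re, UpperHalfPlane.coe_im, hsq_re]
    ring
  have him : (formEval x w).im = w.im * (2 * w.re * x 0 + x 1) := by
    simp only [formEval, add_im, mul_im, ofReal_re, ofReal_im, zero_mul, add_zero,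
      UpperHalfPlane.coe_re, UpperHalfPlane.coe_im, hsq_im]
    ring
  rw [← Complex.normSq_eq_norm_sq, Complex.normSq_apply, majorant_eq]
  rw [show (formEval x w).re * (formEval x w).re = (formEval x w).re ^ 2 by ring,
    show (formEval x w).im * (formEval x w).im = (formEval x w).im ^ 2 by ring, hre, him]
  have hv2 : 0 < w.im ^ 2 := by positivity
  rw [show w.im ^ 2 * (2 * w.im ^ 2 * x 0 ^ 2 + (2 * w.re * x 0 + x 1) ^ 2 +
      2 * (w.re ^ 2 * x 0 + w.re * x 1 + x 2) ^ 2 / w.im ^ 2) =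
      2 * w.im ^ 4 * x 0 ^ 2 + w.im ^ 2 * (2 * w.re * x 0 + x 1) ^ 2 +
      2 * (w.re ^ 2 * x 0 + w.re * x 1 + x 2) ^ 2 by
        rw [mul_add, mul_add, mul_div_assoc', mul_div_cancel_left₀ _ hv2.ne']; ring]
  nlinarith [sq_nonneg ((w.re ^ 2 * x 0 + w.re * x 1 + x 2) + x 0 * w.im ^ 2)]

/-- `√m ≤ e^{am/2}/√(2a)` (`e^t ≥ 1 + t ≥ 2√t`). [folklore] -/
theorem sqrt_le_exp_mul_div {a m : ℝ} (ha : 0 < a) (hm : 0 ≤ m) :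
    Real.sqrt m ≤ Real.exp (a * m / 2) / Real.sqrt (2 * a) := by
  have h2a : 0 < Real.sqrt (2 * a) := Real.sqrt_pos.mpr (by positivity)
  rw [le_div_iff₀ h2a, ← Real.sqrt_mul hm]
  have h1 : Real.sqrt (m * (2 * a)) ≤ 1 + a * m / 2 := by
    rw [Real.sqrt_le_left (by positivity)]
    nlinarith [sq_nonneg (1 - a * m / 2)]
  exact h1.trans (by linarith [Real.add_one_le_exp (a * m / 2)])

/-- `|x(w,1)| e^{-a·majorant} ≤ (Im w/√(2a)) e^{-(a/2)·majorant}`. [folklore] -/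
theorem norm_formEval_mul_exp_le {a : ℝ} (ha : 0 < a) (w : ℍ) (x : V) :
    ‖formEval x w‖ * Real.exp (-a * majorant w x) ≤
      w.im / Real.sqrt (2 * a) * Real.exp (-(a / 2) * majorant w x) := by
  have hv : 0 < w.im := w.im_pos
  obtain ⟨c, hc, hcx⟩ := exists_pos_mul_norm_sq_le_majorant w
  have hm : 0 ≤ majorant w x := le_trans (by positivity) (hcx x)
  have h1 : ‖formEval x w‖ ≤ w.im * Real.sqrt (majorant w x) := by
    have := norm_formEval_sq_le w x
    rw [← Real.sqrt_le_sqrt_iff (by positivity)] at this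
    rwa [Real.sqrt_sq (norm_nonneg _), Real.sqrt_mul (sq_nonneg _), Real.sqrt_sq hv.le] at this
  have h2 := sqrt_le_exp_mul_div ha hm
  calc ‖formEval x w‖ * Real.exp (-a * majorant w x)
      ≤ w.im * (Real.exp (a * majorant w x / 2) / Real.sqrt (2 * a)) * Real.exp (-a * majorant w x) := by
        gcongr
        exact h1.trans (mul_le_mul_of_nonneg_left h2 hv.le)
    _ = w.im / Real.sqrt (2 * a) * Real.exp (-(a / 2) * majorant w x) := by
        rw [show -(a / 2) * majorant w x = a * majorant w x / 2 + -a * majorant w x by ring,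
          Real.exp_add]
        ring

/-! ### The lattice sum -/

/-- `ℤ × ℤ × ℤ ≃ ℤ³`. [folklore] -/
def tripleEquiv : ℤ × ℤ × ℤ ≃ (Fin 3 → ℤ) where
  toFun p := ![p.1, p.2.1, p.2.2]
  invFun k := (k 0, k 1, k 2)
  left_inv p := by simp
  right_inv k := by funext i; fin_cases i <;> rfl

/-- The summand as a product of three one-dimensional Gaussians. [folklore] -/
theorem exp_neg_majorant_eq (a : ℝ) (w : ℍ) (k : Fin 3 → ℤ) :
    Real.exp (-a * majorant w (vec k)) =
      Real.exp (-(2 * a * w.im ^ 2) * (k 0 : ℝ) ^ 2) *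
      Real.exp (-a * ((k 1 : ℝ) - (-(2 * w.re * k 0))) ^ 2) *
      Real.exp (-(2 * a / w.im ^ 2) * ((k 2 : ℝ) - (-(w.re ^ 2 * k 0 + w.re * k 1))) ^ 2) := by
  rw [← Real.exp_add, ← Real.exp_add, majorant_eq]
  congr 1
  simp only [vec_apply]
  have hv : w.im ≠ 0 := w.im_pos.ne'
  field_simp
  ring

/-- **The uniform bound for the majorant theta sum (finite partial sums)**: for `Im w ≥ v₀ > 0`,
`∑_{x ∈ S} e^{-a·majorant_w(x)} ≤ Θ(2av₀²) Θ(a) Θ(2a/v₀²) (Im w/v₀)` for every finite `S ⊆ ℤ³`.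
[cite: Shintani1975, §2] -/
theorem sum_exp_neg_majorant_le {a v₀ : ℝ} (ha : 0 < a) (hv₀ : 0 < v₀) (w : ℍ) (hw : v₀ ≤ w.im)
    (S : Finset (Fin 3 → ℤ)) :
    ∑ k ∈ S, Real.exp (-a * majorant w (vec k)) ≤
      thetaZ (2 * a * v₀ ^ 2) * thetaZ a * thetaZ (2 * a / v₀ ^ 2) * (w.im / v₀) := by
  classical
  have hv : 0 < w.im := w.im_pos
  set t : ℝ := w.im / v₀ with ht
  have ht1 : 1 ≤ t := by rw [ht, le_div_iff₀ hv₀, one_mul]; exact hw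
  -- enlarge `S` to a box `I₀ × I₁ × I₂`
  set I₀ : Finset ℤ := S.image fun k ↦ k 0
  set I₁ : Finset ℤ := S.image fun k ↦ k 1
  set I₂ : Finset ℤ := S.image fun k ↦ k 2
  set B : Finset (Fin 3 → ℤ) := (I₀ ×ˢ (I₁ ×ˢ I₂)).map tripleEquiv.toEmbedding with hB
  have hSB : S ⊆ B := by
    intro k hk
    rw [hB, Finset.mem_map]
    refine ⟨(k 0, k 1, k 2), ?_, ?_⟩
    · simp only [Finset.mem_product, Finset.mem_image, I₀, I₁, I₂]
      exact ⟨⟨k, hk, rfl⟩, ⟨k, hk, rfl⟩, ⟨k, hk, rfl⟩⟩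
    · funext i; fin_cases i <;> rfl
  have hnn : ∀ k ∈ B, 0 ≤ Real.exp (-a * majorant w (vec k)) := fun _ _ ↦ (Real.exp_pos _).le
  refine (Finset.sum_le_sum_of_subset_of_nonneg hSB (fun k hk _ ↦ hnn k hk)).trans ?_
  rw [hB, Finset.sum_map, Finset.sum_product]
  simp only [Equiv.toEmbedding_apply, Finset.sum_product]
  -- the summand in product form
  have hterm : ∀ (x0 x1 x2 : ℤ), Real.exp (-a * majorant w (vec (tripleEquiv (x0, x1, x2)))) =
      Real.exp (-(2 * a * w.im ^ 2) * (x0 : ℝ) ^ 2) *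
      (Real.exp (-a * ((x1 : ℝ) - (-(2 * w.re * x0))) ^ 2) *
      Real.exp (-(2 * a / w.im ^ 2) * ((x2 : ℝ) - (-(w.re ^ 2 * x0 + w.re * x1))) ^ 2)) := by
    intro x0 x1 x2
    rw [exp_neg_majorant_eq, mul_assoc]
    rfl
  simp_rw [hterm, ← Finset.mul_sum]
  -- innermost sum: scaled Banaszczyk
  have hin : ∀ x0 x1 : ℤ, ∑ x2 ∈ I₂,
      Real.exp (-(2 * a / w.im ^ 2) * ((x2 : ℝ) - (-(w.re ^ 2 * x0 + w.re * x1))) ^ 2) ≤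
      t * thetaZ (2 * a / v₀ ^ 2) := by
    intro x0 x1
    have e : 2 * a / w.im ^ 2 = (2 * a / v₀ ^ 2) / t ^ 2 := by
      rw [ht]; field_simp
    rw [e]
    exact sum_exp_neg_mul_sq_sub_le_mul (by positivity) ht1 _ _
  have hmid : ∀ x0 : ℤ, ∑ x1 ∈ I₁, Real.exp (-a * ((x1 : ℝ) - (-(2 * w.re * x0))) ^ 2) ≤ thetaZ a :=
    fun x0 ↦ sum_exp_neg_mul_sq_sub_le ha _ _
  have hout : ∑ x0 ∈ I₀, Real.exp (-(2 * a * w.im ^ 2) * (x0 : ℝ) ^ 2) ≤ thetaZ (2 * a * v₀ ^ 2) := by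
    calc ∑ x0 ∈ I₀, Real.exp (-(2 * a * w.im ^ 2) * (x0 : ℝ) ^ 2)
        ≤ ∑ x0 ∈ I₀, Real.exp (-(2 * a * v₀ ^ 2) * ((x0 : ℝ) - 0) ^ 2) := by
          refine Finset.sum_le_sum fun x0 _ ↦ Real.exp_le_exp.mpr ?_
          rw [sub_zero]
          have : v₀ ^ 2 ≤ w.im ^ 2 := pow_le_pow_left₀ hv₀.le hw 2
          nlinarith [sq_nonneg (x0 : ℝ), mul_nonneg ha.le (sq_nonneg (x0 : ℝ))]
      _ ≤ thetaZ (2 * a * v₀ ^ 2) := sum_exp_neg_mul_sq_sub_le (by positivity) 0 _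
  -- assemble
  have hθ₂ : 0 ≤ t * thetaZ (2 * a / v₀ ^ 2) := mul_nonneg (by positivity) (thetaZ_nonneg _)
  calc ∑ x0 ∈ I₀, Real.exp (-(2 * a * w.im ^ 2) * (x0 : ℝ) ^ 2) *
        ∑ x1 ∈ I₁, Real.exp (-a * ((x1 : ℝ) - (-(2 * w.re * x0))) ^ 2) *
          ∑ x2 ∈ I₂, Real.exp (-(2 * a / w.im ^ 2) * ((x2 : ℝ) - (-(w.re ^ 2 * x0 + w.re * x1))) ^ 2)
      ≤ ∑ x0 ∈ I₀, Real.exp (-(2 * a * w.im ^ 2) * (x0 : ℝ) ^ 2) *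
        ∑ x1 ∈ I₁, Real.exp (-a * ((x1 : ℝ) - (-(2 * w.re * x0))) ^ 2) *
          (t * thetaZ (2 * a / v₀ ^ 2)) := by
        gcongr with x0 _ x1 _
        exact hin x0 x1
    _ = (∑ x0 ∈ I₀, Real.exp (-(2 * a * w.im ^ 2) * (x0 : ℝ) ^ 2) *
        ∑ x1 ∈ I₁, Real.exp (-a * ((x1 : ℝ) - (-(2 * w.re * x0))) ^ 2)) *
          (t * thetaZ (2 * a / v₀ ^ 2)) := by
        rw [Finset.sum_mul]
        refine Finset.sum_congr rfl fun x0 _ ↦ ?_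
        rw [Finset.mul_sum, Finset.mul_sum, Finset.sum_mul]
        refine Finset.sum_congr rfl fun x1 _ ↦ ?_
        ring
    _ ≤ (∑ x0 ∈ I₀, Real.exp (-(2 * a * w.im ^ 2) * (x0 : ℝ) ^ 2) * thetaZ a) *
          (t * thetaZ (2 * a / v₀ ^ 2)) := by
        gcongr with x0 _
        exact hmid x0
    _ ≤ (thetaZ (2 * a * v₀ ^ 2) * thetaZ a) * (t * thetaZ (2 * a / v₀ ^ 2)) := by
        rw [← Finset.sum_mul]
        gcongr
        · exact thetaZ_nonneg _
    _ = thetaZ (2 * a * v₀ ^ 2) * thetaZ a * thetaZ (2 * a / v₀ ^ 2) * (w.im / v₀) := by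
        rw [ht]; ring

/-- **Summability and the bound for the full theta sum.** [cite: Shintani1975, §2] -/
theorem summable_exp_neg_majorant {a : ℝ} (ha : 0 < a) (w : ℍ) :
    Summable fun k : Fin 3 → ℤ ↦ Real.exp (-a * majorant w (vec k)) :=
  summable_of_sum_le (fun _ ↦ (Real.exp_pos _).le)
    (sum_exp_neg_majorant_le ha w.im_pos w le_rfl)

/-- `∑_{x ∈ ℤ³} e^{-a·majorant_w(x)} ≤ Θ(2av₀²) Θ(a) Θ(2a/v₀²) (Im w/v₀)` for `Im w ≥ v₀`.
[cite: Shintani1975, §2] -/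
theorem tsum_exp_neg_majorant_le {a v₀ : ℝ} (ha : 0 < a) (hv₀ : 0 < v₀) (w : ℍ) (hw : v₀ ≤ w.im) :
    ∑' k : Fin 3 → ℤ, Real.exp (-a * majorant w (vec k)) ≤
      thetaZ (2 * a * v₀ ^ 2) * thetaZ a * thetaZ (2 * a / v₀ ^ 2) * (w.im / v₀) :=
  Real.tsum_le_of_sum_le (fun _ ↦ (Real.exp_pos _).le) (sum_exp_neg_majorant_le ha hv₀ w hw)

/-- **The weighted theta sum**: `∑_x |x(w,1)| e^{-a·majorant_w(x)} ≤ C(a, v₀) (Im w)²` for `Im w ≥ v₀`,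
with `C(a, v₀) = Θ(av₀²) Θ(a/2) Θ(a/v₀²) / (v₀ √(2a))`. [cite: Shintani1975, §2] -/
theorem tsum_norm_formEval_mul_exp_le {a v₀ : ℝ} (ha : 0 < a) (hv₀ : 0 < v₀) (w : ℍ) (hw : v₀ ≤ w.im) :
    (Summable fun k : Fin 3 → ℤ ↦ ‖formEval (vec k) w‖ * Real.exp (-a * majorant w (vec k))) ∧
    ∑' k : Fin 3 → ℤ, ‖formEval (vec k) w‖ * Real.exp (-a * majorant w (vec k)) ≤
      thetaZ (2 * (a / 2) * v₀ ^ 2) * thetaZ (a / 2) * thetaZ (2 * (a / 2) / v₀ ^ 2) /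
        (v₀ * Real.sqrt (2 * a)) * w.im ^ 2 := by
  have ha2 : 0 < a / 2 := by positivity
  have hv : 0 < w.im := w.im_pos
  have hpt : ∀ k : Fin 3 → ℤ, ‖formEval (vec k) w‖ * Real.exp (-a * majorant w (vec k)) ≤
      w.im / Real.sqrt (2 * a) * Real.exp (-(a / 2) * majorant w (vec k)) :=
    fun k ↦ norm_formEval_mul_exp_le ha w (vec k)
  have hs := (summable_exp_neg_majorant ha2 w).mul_left (w.im / Real.sqrt (2 * a))
  have hsum : Summable fun k : Fin 3 → ℤ ↦ ‖formEval (vec k) w‖ * Real.exp (-a * majorant w (vec k)) :=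
    Summable.of_nonneg_of_le (fun _ ↦ by positivity) hpt hs
  refine ⟨hsum, ?_⟩
  calc ∑' k : Fin 3 → ℤ, ‖formEval (vec k) w‖ * Real.exp (-a * majorant w (vec k))
      ≤ ∑' k : Fin 3 → ℤ, w.im / Real.sqrt (2 * a) * Real.exp (-(a / 2) * majorant w (vec k)) :=
        hsum.tsum_le_tsum hpt hs
    _ = w.im / Real.sqrt (2 * a) * ∑' k : Fin 3 → ℤ, Real.exp (-(a / 2) * majorant w (vec k)) :=
        tsum_mul_left
    _ ≤ w.im / Real.sqrt (2 * a) *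
        (thetaZ (2 * (a / 2) * v₀ ^ 2) * thetaZ (a / 2) * thetaZ (2 * (a / 2) / v₀ ^ 2) * (w.im / v₀)) := by
        gcongr
        exact tsum_exp_neg_majorant_le ha2 hv₀ w hw
    _ = _ := by
        field_simp

end Literature.NumberTheory.EllipticCurves.Shintani
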